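import Literature.Analysis.SpecialFunctions.SelbergAomotoCalculus
import Mathlib.MeasureTheory.Measure.Lebesgue.EqHaar
import Mathlib.MeasureTheory.Integral.DominatedConvergence
import Mathlib.Analysis.SpecialFunctions.Integrals.Basic
import HarnessLib

/-!
# Selberg's normalisation: the limit `a → 0⁺` of `a · Sₙ(a, b, c)`

The `n ↦ n+1` step in the determination of the constant in Selberg's formula
(A. Selberg, Norsk Mat. Tidsskr. 26 (1944) 71–78; G. E. Andrews, R. Askey, R. Roy,
*Special Functions* (1999), §8.2; P. J. Forrester, S. O. Warnaar, Bull. AMS 45 (2008), §1):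
for `b, c ≥ 1`,

  `a · S_{m+1}(a, b, c) → (m+1) · S_m(2c, b, c)`   as `a → 0⁺`.

Proof: decompose the cube according to which coordinate is the smallest (the overlaps are
Lebesgue-null and the `m+1` pieces have equal integrals by symmetry), so that
`S_{m+1} = (m+1) ∫_{t₀ = min} W`; on the piece `t₀ = min` write `t = t₀ ∷ u` and integrate in `u`
first (Fubini): the inner integral is `t₀^{a-1}(1-t₀)^{b-1} Ψₐ(t₀)` with `Ψₐ` bounded by `1` and
`Ψₐ(x) → S_m(2c, b, c)` as `(a, x) → (0⁺, 0⁺)` (dominated convergence, dominating function `1`);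
finally `a ∫₀¹ x^{a-1} H(a, x) dx → lim H` for bounded `H` (an approximate identity).
The Gamma-side counterpart is `Selberg.tendsto_mul_selbergProduct_succ`.

Everything here is fully proved; no named facts.
-/

noncomputable section

open MeasureTheory Real Finset Set Filter Topology

namespace Literature.Analysis.SpecialFunctions

namespace Selberg

/-! ### Coincidences of coordinates are null -/

/-- The hyperplane `{t_p = t_q}` (`p ≠ q`) is Lebesgue-null. [folklore] -/
theorem volume_setOf_apply_eq {n : ℕ} {p q : Fin n} (hpq : p ≠ q) :
    volume {t : Fin n → ℝ | t p = t q} = 0 := by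
  let L : (Fin n → ℝ) →ₗ[ℝ] ℝ :=
    LinearMap.proj (R := ℝ) (φ := fun _ : Fin n => ℝ) p - LinearMap.proj (R := ℝ) (φ := fun _ : Fin n => ℝ) q
  have hker : ((LinearMap.ker L : Submodule ℝ (Fin n → ℝ)) : Set (Fin n → ℝ)) =
      {t | t p = t q} := by
    ext t
    simp [L, sub_eq_zero]
  have hne : LinearMap.ker L ≠ ⊤ := by
    intro h
    have hmem : (Pi.single p 1 : Fin n → ℝ) ∈ LinearMap.ker L := h ▸ Submodule.mem_top
    rw [LinearMap.mem_ker] at hmem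
    simp [L, Pi.single_eq_of_ne hpq.symm] at hmem
  rw [← hker]
  exact Measure.addHaar_submodule volume _ hne

/-- Almost every point of `ℝⁿ` has pairwise distinct coordinates. [folklore] -/
theorem ae_injective (n : ℕ) : ∀ᵐ t : Fin n → ℝ, Function.Injective t := by
  have h : ∀ p q : Fin n, p ≠ q → ∀ᵐ t : Fin n → ℝ, t p ≠ t q := by
    intro p q hpq
    rw [ae_iff]
    simpa using volume_setOf_apply_eq hpq
  have h' : ∀ᵐ t : Fin n → ℝ, ∀ p q : Fin n, p ≠ q → t p ≠ t q := by
    rw [ae_all_iff]; intro p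
    rw [ae_all_iff]; intro q
    by_cases hpq : p = q
    · exact Eventually.of_forall fun t h => (h hpq).elim
    · filter_upwards [h p q hpq] with t ht using fun _ => ht
  filter_upwards [h'] with t ht
  intro p q hpq
  by_contra h
  exact ht p q h hpq

/-! ### The decomposition according to the smallest coordinate -/

/-- The closed region where the coordinate `p` is the smallest. [folklore] -/
def argminSet (n : ℕ) (p : Fin n) : Set (Fin n → ℝ) := {t | ∀ q, t p ≤ t q}

/-- `argminSet` is measurable. [folklore] -/
theorem measurableSet_argminSet (n : ℕ) (p : Fin n) : MeasurableSet (argminSet n p) := by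
  have : argminSet n p = ⋂ q, {t : Fin n → ℝ | t p ≤ t q} := by
    ext t; simp [argminSet]
  rw [this]
  exact MeasurableSet.iInter fun q =>
    measurableSet_le (measurable_pi_apply p) (measurable_pi_apply q)

/-- At a point with distinct coordinates exactly one coordinate is the smallest. [folklore] -/
theorem sum_indicator_argminSet {m : ℕ} {t : Fin (m + 1) → ℝ} (ht : Function.Injective t)
    (f : (Fin (m + 1) → ℝ) → ℝ) :
    ∑ p : Fin (m + 1), (argminSet (m + 1) p).indicator f t = f t := by
  classical
  obtain ⟨p₀, -, hp₀⟩ := Finset.exists_min_image Finset.univ t ⟨0, Finset.mem_univ _⟩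
  have hmem : ∀ p, t ∈ argminSet (m + 1) p ↔ p = p₀ := by
    intro p
    constructor
    · intro hp
      exact ht (le_antisymm (hp p₀) (hp₀ p (Finset.mem_univ _)))
    · rintro rfl
      exact fun q => hp₀ q (Finset.mem_univ _)
  rw [Finset.sum_eq_single p₀]
  · rw [Set.indicator_of_mem ((hmem p₀).2 rfl)]
  · intro p _ hp
    rw [Set.indicator_of_notMem]
    exact fun h => hp ((hmem p).1 h)
  · simp

/-- The pieces of the decomposition have equal integrals, by symmetry. [folklore] -/
theorem integral_indicator_argminSet_eq {m : ℕ} (a b c : ℝ) (p : Fin (m + 1)) :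
    ∫ t in cube (m + 1), (argminSet (m + 1) p).indicator (weight (m + 1) a b c) t =
      ∫ t in cube (m + 1), (argminSet (m + 1) 0).indicator (weight (m + 1) a b c) t := by
  rw [← integral_cube_comp_perm (Equiv.swap 0 p)
    (fun t => (argminSet (m + 1) 0).indicator (weight (m + 1) a b c) t)]
  refine setIntegral_congr_fun (measurableSet_cube _) fun t _ => ?_
  have hmem : t ∘ Equiv.swap 0 p ∈ argminSet (m + 1) 0 ↔ t ∈ argminSet (m + 1) p := by
    simp only [argminSet, Set.mem_setOf_eq, Function.comp_apply, Equiv.swap_apply_left]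
    constructor
    · intro h q
      simpa using h (Equiv.swap 0 p q)
    · intro h q
      exact h _
  by_cases h : t ∈ argminSet (m + 1) p
  · rw [Set.indicator_of_mem h, Set.indicator_of_mem (hmem.2 h), weight_comp_perm]
  · rw [Set.indicator_of_notMem h, Set.indicator_of_notMem (fun h' => h (hmem.1 h'))]

/-- **Decomposition according to the smallest coordinate**:
`S_{m+1}(a,b,c) = (m+1) ∫_{[0,1]^{m+1} ∩ {t₀ = min}} W`, whenever the weight is integrable.
[folklore] -/
theorem selbergIntegral_eq_mul_integral_argmin {m : ℕ} {a b c : ℝ}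
    (hint : IntegrableOn (weight (m + 1) a b c) (cube (m + 1))) :
    selbergIntegral (m + 1) a b c =
      (m + 1) * ∫ t in cube (m + 1), (argminSet (m + 1) 0).indicator (weight (m + 1) a b c) t := by
  rw [selbergIntegral_eq_integral_weight]
  have hae : ∀ᵐ t ∂(volume.restrict (cube (m + 1))), weight (m + 1) a b c t =
      ∑ p : Fin (m + 1), (argminSet (m + 1) p).indicator (weight (m + 1) a b c) t := by
    filter_upwards [ae_restrict_of_ae (ae_injective (m + 1))] with t ht
    rw [sum_indicator_argminSet ht]
  rw [integral_congr_ae hae, integral_finsetSum]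
  · simp_rw [integral_indicator_argminSet_eq a b c]
    rw [Finset.sum_const, Finset.card_univ, Fintype.card_fin, nsmul_eq_mul]
    push_cast
    ring
  · intro p _
    exact hint.indicator (measurableSet_argminSet _ p)

/-! ### Fubini with the coordinate `0` outermost -/

/-- **Fubini on the cube**, coordinate `0` outermost:
`∫_{[0,1]^{m+1}} D = ∫_{x ∈ [0,1]} ∫_{u ∈ [0,1]^m} D(x ∷ u)`, and the inner integral is an
integrable function of `x`. [folklore] -/
theorem integral_cube_succ' {m : ℕ} (D : (Fin (m + 1) → ℝ) → ℝ)
    (hD : IntegrableOn D (cube (m + 1))) :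
    (∫ t in cube (m + 1), D t = ∫ x in Icc (0 : ℝ) 1, ∫ u in cube m, D (Fin.cons x u)) ∧
      IntegrableOn (fun x => ∫ u in cube m, D (Fin.cons x u)) (Icc (0 : ℝ) 1) := by
  set e := (MeasurableEquiv.piFinSuccAbove (fun _ : Fin (m + 1) => ℝ) 0).symm with he
  have hmp : MeasurePreserving e (volume.prod volume) volume :=
    (volume_preserving_piFinSuccAbove (fun _ : Fin (m + 1) => ℝ) 0).symm _
  have happ : ∀ p, e p = Fin.cons p.1 p.2 := piFinSuccAbove_symm_apply_eq_cons
  have hpre : e ⁻¹' cube (m + 1) = Icc (0 : ℝ) 1 ×ˢ cube m := by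
    ext ⟨x, u⟩
    rw [Set.mem_preimage, happ, cons_mem_cube_iff, Set.mem_prod]
  have h1 := hmp.setIntegral_preimage_emb e.measurableEmbedding D (cube (m + 1))
  have hint : Integrable (fun p : ℝ × (Fin m → ℝ) => D (e p))
      ((volume.restrict (Icc (0 : ℝ) 1)).prod (volume.restrict (cube m))) := by
    have h2 := hmp.restrict_preimage_emb e.measurableEmbedding (cube (m + 1))
    rw [hpre, ← Measure.prod_restrict] at h2
    exact (h2.integrable_comp_emb e.measurableEmbedding).2 hD
  constructor
  · rw [← h1, hpre, ← Measure.prod_restrict, integral_prod _ hint]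
    simp only [happ]
  · have := hint.integral_prod_left
    simp only [happ] at this
    exact this

/-! ### An approximate identity: `a ∫₀¹ x^{a-1} H(a,x) dx → lim H` -/

/-- `∫_s^t x^{a-1} dx = (t^a - s^a)/a` for `a > 0`. [folklore] -/
theorem integral_rpow_sub_one {a : ℝ} (ha : 0 < a) (s t : ℝ) :
    ∫ x in s..t, x ^ (a - 1) = (t ^ a - s ^ a) / a := by
  rw [integral_rpow (Or.inl (by linarith)), show a - 1 + 1 = a by ring]

/-- **Approximate identity.** If `|g(a, x)| ≤ M x^{a-1}` on `(0,1]` and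
`|g(a,x) - L x^{a-1}| ≤ ε x^{a-1}` for `a, x` small, then `a ∫₀¹ g(a, x) dx → L` as `a → 0⁺`.
[folklore] -/
theorem tendsto_mul_integral_of_approx {g : ℝ → ℝ → ℝ} {M L : ℝ} (hM : 0 ≤ M)
    (hint : ∀ a, 0 < a → a < 1 → IntegrableOn (g a) (Ioo 0 1))
    (hbound : ∀ a, 0 < a → a < 1 → ∀ x ∈ Ioc (0 : ℝ) 1, |g a x| ≤ M * x ^ (a - 1))
    (hlim : ∀ ε > 0, ∃ δ > 0, ∀ a, 0 < a → a < δ → ∀ x, 0 < x → x < δ →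
      |g a x - L * x ^ (a - 1)| ≤ ε * x ^ (a - 1)) :
    Tendsto (fun a => a * ∫ x in Ioo (0 : ℝ) 1, g a x) (𝓝[>] 0) (𝓝 L) := by
  rw [Metric.tendsto_nhdsWithin_nhds]
  intro ε hε
  obtain ⟨δ, hδ, hδlim⟩ := hlim (ε / 3) (by positivity)
  -- split point `d`
  set d : ℝ := min (δ / 2) (1 / 2) with hd
  have hd0 : 0 < d := by positivity
  have hd1 : d < 1 := by
    have : d ≤ 1 / 2 := min_le_right _ _
    linarith
  have hdδ : d < δ := by
    have : d ≤ δ / 2 := min_le_left _ _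
    linarith
  -- `d ^ a → 1` as `a → 0`
  have hcont : Tendsto (fun a : ℝ => d ^ a) (𝓝 0) (𝓝 1) := by
    have := (continuousAt_const_rpow (b := 0) hd0.ne').tendsto
    simpa using this
  have hK : 0 < M + |L| + 1 := by positivity
  obtain ⟨a₁, ha₁, ha₁lim⟩ := Metric.tendsto_nhds_nhds.1 hcont (ε / (3 * (M + |L| + 1)))
    (by positivity)
  refine ⟨min a₁ (min δ 1), by positivity, fun a ha hdist => ?_⟩
  rw [Set.mem_Ioi] at ha
  rw [Real.dist_eq, sub_zero, abs_of_pos ha] at hdist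
  have ha₁' : a < a₁ := lt_of_lt_of_le hdist (min_le_left _ _)
  have haδ : a < δ := lt_of_lt_of_le hdist ((min_le_right _ _).trans (min_le_left _ _))
  have ha1 : a < 1 := lt_of_lt_of_le hdist ((min_le_right _ _).trans (min_le_right _ _))
  have hda : 0 < d ^ a := rpow_pos_of_pos hd0 a
  have hda1 : d ^ a ≤ 1 := rpow_le_one hd0.le hd1.le ha.le
  have hda_close : 1 - d ^ a < ε / (3 * (M + |L| + 1)) := by
    have h := @ha₁lim a (by rwa [Real.dist_eq, sub_zero, abs_of_pos ha])
    rw [Real.dist_eq] at h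
    linarith [neg_abs_le (d ^ a - 1)]
  -- integrability
  have hgi' : IntervalIntegrable (g a) volume 0 1 := by
    rw [intervalIntegrable_iff_integrableOn_Ioo_of_le zero_le_one]
    exact hint a ha ha1
  have hpow : ∀ s t : ℝ, IntervalIntegrable (fun x : ℝ => x ^ (a - 1)) volume s t :=
    fun s t => intervalIntegral.intervalIntegrable_rpow' (by linarith)
  have hg0d : IntervalIntegrable (g a) volume 0 d := hgi'.mono_set (by
    rw [Set.uIcc_of_le zero_le_one, Set.uIcc_of_le hd0.le]
    exact Set.Icc_subset_Icc le_rfl hd1.le)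
  have hgd1 : IntervalIntegrable (g a) volume d 1 := hgi'.mono_set (by
    rw [Set.uIcc_of_le zero_le_one, Set.uIcc_of_le hd1.le]
    exact Set.Icc_subset_Icc hd0.le le_rfl)
  have hsplit : ∫ x in Ioo (0 : ℝ) 1, g a x =
      (∫ x in (0 : ℝ)..d, g a x) + ∫ x in d..1, g a x := by
    rw [intervalIntegral.integral_add_adjacent_intervals hg0d hgd1,
      intervalIntegral.integral_of_le zero_le_one, integral_Ioc_eq_integral_Ioo]
  -- (A) the piece near `0`
  have hA : |a * (∫ x in (0 : ℝ)..d, g a x) - L * d ^ a| ≤ ε / 3 := by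
    have e1 : a * (∫ x in (0 : ℝ)..d, g a x) - L * d ^ a =
        a * ∫ x in (0 : ℝ)..d, (g a x - L * x ^ (a - 1)) := by
      rw [intervalIntegral.integral_sub hg0d ((hpow 0 d).const_mul L),
        intervalIntegral.integral_const_mul, integral_rpow_sub_one ha 0 d,
        Real.zero_rpow ha.ne']
      field_simp
      ring
    have e2 : |∫ x in (0 : ℝ)..d, (g a x - L * x ^ (a - 1))| ≤
        ∫ x in (0 : ℝ)..d, ε / 3 * x ^ (a - 1) := by
      have h := intervalIntegral.norm_integral_le_of_norm_le (μ := volume)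
        (f := fun x => g a x - L * x ^ (a - 1)) (g := fun x => ε / 3 * x ^ (a - 1)) hd0.le
        (Eventually.of_forall fun x hx => ?_) ((hpow 0 d).const_mul _)
      · simpa only [Real.norm_eq_abs] using h
      · rw [Real.norm_eq_abs]
        exact hδlim a ha haδ x hx.1 (lt_of_le_of_lt hx.2 hdδ)
    rw [intervalIntegral.integral_const_mul, integral_rpow_sub_one ha 0 d,
      Real.zero_rpow ha.ne', sub_zero] at e2
    rw [e1, abs_mul, abs_of_pos ha]
    calc a * |∫ x in (0 : ℝ)..d, (g a x - L * x ^ (a - 1))| ≤ a * (ε / 3 * (d ^ a / a)) := by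
          gcongr
      _ = ε / 3 * d ^ a := by field_simp
      _ ≤ ε / 3 := by nlinarith
  -- (B) the piece away from `0`
  have hB : |a * ∫ x in d..1, g a x| ≤ M * (1 - d ^ a) := by
    have e2 : |∫ x in d..1, g a x| ≤ ∫ x in d..1, M * x ^ (a - 1) := by
      have h := intervalIntegral.norm_integral_le_of_norm_le (μ := volume) (f := g a)
        (g := fun x => M * x ^ (a - 1)) hd1.le (Eventually.of_forall fun x hx => ?_)
        ((hpow d 1).const_mul _)
      · simpa only [Real.norm_eq_abs] using h
      · rw [Real.norm_eq_abs]
        exact hbound a ha ha1 x ⟨hd0.trans hx.1, hx.2⟩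
    rw [intervalIntegral.integral_const_mul, integral_rpow_sub_one ha d 1,
      Real.one_rpow] at e2
    rw [abs_mul, abs_of_pos ha]
    calc a * |∫ x in d..1, g a x| ≤ a * (M * ((1 - d ^ a) / a)) := by gcongr
      _ = M * (1 - d ^ a) := by field_simp
  -- (C) and the total
  have hC : |L * d ^ a - L| = |L| * (1 - d ^ a) := by
    rw [show L * d ^ a - L = -(L * (1 - d ^ a)) by ring, abs_neg, abs_mul,
      abs_of_nonneg (by linarith : 0 ≤ 1 - d ^ a)]
  rw [Real.dist_eq, hsplit, mul_add,
    show a * (∫ x in (0 : ℝ)..d, g a x) + a * (∫ x in d..1, g a x) - L =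
      (a * (∫ x in (0 : ℝ)..d, g a x) - L * d ^ a) + a * (∫ x in d..1, g a x) + (L * d ^ a - L)
      by ring]
  calc |(a * (∫ x in (0 : ℝ)..d, g a x) - L * d ^ a) + a * (∫ x in d..1, g a x) +
          (L * d ^ a - L)|
      ≤ |a * (∫ x in (0 : ℝ)..d, g a x) - L * d ^ a| + |a * ∫ x in d..1, g a x| +
          |L * d ^ a - L| := abs_add_three _ _ _
    _ ≤ ε / 3 + M * (1 - d ^ a) + |L| * (1 - d ^ a) := by rw [hC]; gcongr
    _ < ε := by
        have h1 : (M + |L|) * (1 - d ^ a) ≤ (M + |L| + 1) * (ε / (3 * (M + |L| + 1))) :=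
          mul_le_mul (by linarith) hda_close.le (by linarith) (by positivity)
        have h2 : (M + |L| + 1) * (ε / (3 * (M + |L| + 1))) = ε / 3 := by
          field_simp
        nlinarith [h1, h2, abs_nonneg L]

/-! ### The integrand on the piece `t₀ = min`, in the coordinates `x ∷ u` -/

/-- The indicator of `{t₀ = min}` at `x ∷ u`. [folklore] -/
theorem indicator_argminSet_cons {m : ℕ} (x : ℝ) (u : Fin m → ℝ) (f : (Fin (m + 1) → ℝ) → ℝ) :
    (argminSet (m + 1) 0).indicator f (Fin.cons x u) =
      if ∀ j : Fin m, x ≤ u j then f (Fin.cons x u) else 0 := by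
  simp only [Set.indicator_apply, argminSet, Set.mem_setOf_eq, Fin.forall_fin_succ, Fin.cons_zero,
    Fin.cons_succ, le_refl, true_and]

/-- The Selberg weight at `x ∷ u`. [folklore] -/
theorem weight_cons (m : ℕ) (a b c x : ℝ) (u : Fin m → ℝ) :
    weight (m + 1) a b c (Fin.cons x u) =
      x ^ (a - 1) * (1 - x) ^ (b - 1) * ((∏ j : Fin m, ((x - u j) ^ 2) ^ c) * weight m a b c u) := by
  rw [weight_eq_body_mul_pairSym, body_cons, pairSym_cons, weight_eq_body_mul_pairSym]
  ring

/-- The reduced integrand `F(a, x; u) = 𝟙[x ≤ uⱼ ∀ j] ∏ⱼ ((x-uⱼ)²)^c W_m^{(a,b,c)}(u)`. [folklore] -/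
def redWeight (m : ℕ) (b c : ℝ) (p : ℝ × ℝ) (u : Fin m → ℝ) : ℝ :=
  (if ∀ j : Fin m, p.2 ≤ u j then 1 else 0) * (∏ j : Fin m, ((p.2 - u j) ^ 2) ^ c) *
    weight m p.1 b c u

/-- The indicator-weighted Selberg weight at `x ∷ u` factors through `redWeight`. [folklore] -/
theorem indicator_weight_cons {m : ℕ} (a b c x : ℝ) (u : Fin m → ℝ) :
    (argminSet (m + 1) 0).indicator (weight (m + 1) a b c) (Fin.cons x u) =
      x ^ (a - 1) * (1 - x) ^ (b - 1) * redWeight m b c (a, x) u := by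
  rw [indicator_argminSet_cons, weight_cons, redWeight]
  split_ifs <;> ring

/-- `redWeight` is measurable in `u`. [folklore] -/
theorem measurable_redWeight (m : ℕ) (b c : ℝ) (p : ℝ × ℝ) : Measurable (redWeight m b c p) := by
  unfold redWeight
  refine Measurable.mul (Measurable.mul ?_ ?_) (measurable_weight m p.1 b c)
  · refine Measurable.ite ?_ measurable_const measurable_const
    have : {u : Fin m → ℝ | ∀ j, p.2 ≤ u j} = ⋂ j, {u | p.2 ≤ u j} := by ext u; simp
    rw [this]
    exact MeasurableSet.iInter fun j => measurableSet_le measurable_const (measurable_pi_apply j)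
  · exact Finset.measurable_prod _ fun j _ => by fun_prop

/-- **The uniform bound** `|redWeight| ≤ 1` on the cube, for `a > 0`, `b ≥ 1`, `c ≥ 1`, `x ≥ 0`.
[folklore] -/
theorem abs_redWeight_le_one {m : ℕ} {a b c x : ℝ} (ha : 0 < a) (hb : 1 ≤ b) (hc : 1 ≤ c)
    (hx : 0 ≤ x) {u : Fin m → ℝ} (hu : u ∈ cube m) : |redWeight m b c (a, x) u| ≤ 1 := by
  unfold redWeight
  simp only
  split_ifs with hxu
  · rw [one_mul, weight_eq_body_mul_pairSym, ← mul_assoc,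
      abs_of_nonneg (mul_nonneg (mul_nonneg (prod_nonneg fun j _ => rpow_nonneg (sq_nonneg _) _)
        (body_nonneg a b hu)) (pairSym_nonneg m c u))]
    refine mul_le_one₀ ?_ (pairSym_nonneg m c u) (pairSym_le_one (by linarith) hu)
    rw [body, ← prod_mul_distrib]
    rw [mem_cube_iff] at hu
    refine prod_le_one (fun j _ => ?_) fun j _ => ?_
    · exact mul_nonneg (rpow_nonneg (sq_nonneg _) _)
        (mul_nonneg (rpow_nonneg (hu j).1 _) (rpow_nonneg (by linarith [(hu j).2]) _))
    · have h0 : 0 ≤ u j := (hu j).1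
      have h1 : u j ≤ 1 := (hu j).2
      have hxj : x ≤ u j := hxu j
      -- `((x - u j)^2)^c ≤ (u j)^(2c)`
      have hsq : ((x - u j) ^ 2) ^ c ≤ (u j) ^ (2 * c) := by
        have : (x - u j) ^ 2 ≤ (u j) ^ 2 := by nlinarith
        calc ((x - u j) ^ 2) ^ c ≤ ((u j) ^ 2) ^ c :=
              rpow_le_rpow (sq_nonneg _) this (by linarith)
          _ = (u j) ^ (2 * c) := by
              rw [show (u j) ^ 2 = (u j) ^ (2 : ℝ) by norm_cast, ← rpow_mul h0]
      have hb1 : (1 - u j) ^ (b - 1) ≤ 1 := rpow_le_one (by linarith) (by linarith) (by linarith)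
      calc ((x - u j) ^ 2) ^ c * ((u j) ^ (a - 1) * (1 - u j) ^ (b - 1))
          ≤ (u j) ^ (2 * c) * ((u j) ^ (a - 1) * 1) := by
            gcongr
        _ = (u j) ^ (2 * c) * (u j) ^ (a - 1) := by ring
        _ ≤ 1 := by
            rcases eq_or_lt_of_le h0 with h | h
            · rw [← h, zero_rpow (by linarith), zero_mul]; exact zero_le_one
            · rw [← rpow_add h]
              exact rpow_le_one h0 h1 (by linarith)
  · simp

/-- **The pointwise limit**: for `u` in the open cube, `redWeight(a, x; u) → W_m^{(2c,b,c)}(u)` as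
`(a, x) → (0⁺, 0⁺)`. [folklore] -/
theorem tendsto_redWeight {m : ℕ} (b c : ℝ) (hc : 0 ≤ c) {u : Fin m → ℝ} (hu : ∀ j, 0 < u j) :
    Tendsto (fun p : ℝ × ℝ => redWeight m b c p u) (𝓝[Set.Ioi 0 ×ˢ Set.Ioi 0] ((0 : ℝ), (0 : ℝ)))
      (𝓝 (weight m (2 * c) b c u)) := by
  set l : Filter (ℝ × ℝ) := 𝓝[Set.Ioi 0 ×ˢ Set.Ioi 0] ((0 : ℝ), (0 : ℝ)) with hl
  have hsnd : Tendsto (fun p : ℝ × ℝ => p.2) l (𝓝 0) :=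
    (continuous_snd.tendsto ((0 : ℝ), (0 : ℝ))).mono_left nhdsWithin_le_nhds
  have hfst : Tendsto (fun p : ℝ × ℝ => p.1) l (𝓝 0) :=
    (continuous_fst.tendsto ((0 : ℝ), (0 : ℝ))).mono_left nhdsWithin_le_nhds
  -- the indicator is eventually `1`
  have hind : ∀ᶠ p : ℝ × ℝ in l, (if ∀ j : Fin m, p.2 ≤ u j then (1 : ℝ) else 0) = 1 := by
    have : ∀ᶠ p : ℝ × ℝ in l, ∀ j : Fin m, p.2 ≤ u j := by
      rw [eventually_all]
      intro j
      exact (hsnd.eventually (Iic_mem_nhds (hu j))).mono fun p hp => hp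
    exact this.mono fun p hp => if_pos hp
  -- the pair factor is continuous in `x`
  have hR : Tendsto (fun p : ℝ × ℝ => ∏ j : Fin m, ((p.2 - u j) ^ 2) ^ c) l
      (𝓝 (∏ j : Fin m, ((0 - u j) ^ 2) ^ c)) := by
    have hcont : Continuous fun x : ℝ => ∏ j : Fin m, ((x - u j) ^ 2) ^ c :=
      continuous_finsetProd _ fun j _ => Continuous.rpow_const (by fun_prop) fun _ => Or.inr hc
    exact (hcont.tendsto 0).comp hsnd
  -- the weight is continuous in `a`
  have hW : Tendsto (fun p : ℝ × ℝ => weight m p.1 b c u) l (𝓝 (weight m 0 b c u)) := by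
    have hcont : Continuous fun a : ℝ => weight m a b c u := by
      unfold weight body
      refine Continuous.mul (continuous_finsetProd _ fun j _ => ?_) continuous_const
      refine Continuous.mul ?_ continuous_const
      exact (continuous_const_rpow (hu j).ne').comp (continuous_sub_right 1)
    exact (hcont.tendsto 0).comp hfst
  -- combine
  have hlim := ((tendsto_const_nhds (x := (1 : ℝ))).congr' (hind.mono fun p hp => hp.symm)).mul hR
    |>.mul hW
  refine hlim.congr' (Eventually.of_forall fun p => by simp [redWeight]) |>.trans ?_
  -- identify the limit
  suffices h : 1 * (∏ j : Fin m, ((0 - u j) ^ 2) ^ c) * weight m 0 b c u = weight m (2 * c) b c u by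
    rw [h]
  simp only [one_mul, zero_sub, weight, body, ← mul_assoc]
  congr 1
  rw [← prod_mul_distrib]
  refine prod_congr rfl fun j _ => ?_
  have hj := hu j
  rw [neg_sq, show (u j) ^ 2 = (u j) ^ (2 : ℝ) by norm_cast, ← rpow_mul hj.le, ← mul_assoc,
    ← rpow_add hj]
  ring_nf

/-- **The limit of the inner integral** (dominated convergence with dominating function `1`):
`∫_{[0,1]^m} redWeight(a, x; u) du → S_m(2c, b, c)` as `(a, x) → (0⁺, 0⁺)`, for `b, c ≥ 1`.
[folklore] -/
theorem tendsto_integral_redWeight (m : ℕ) {b c : ℝ} (hb : 1 ≤ b) (hc : 1 ≤ c) :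
    Tendsto (fun p : ℝ × ℝ => ∫ u in cube m, redWeight m b c p u)
      (𝓝[Set.Ioi 0 ×ˢ Set.Ioi 0] ((0 : ℝ), (0 : ℝ))) (𝓝 (selbergIntegral m (2 * c) b c)) := by
  rw [selbergIntegral_eq_integral_weight]
  refine tendsto_integral_filter_of_dominated_convergence (fun _ => (1 : ℝ))
    (Eventually.of_forall fun p => (measurable_redWeight m b c p).aestronglyMeasurable) ?_ ?_ ?_
  · filter_upwards [self_mem_nhdsWithin] with p hp
    rw [Set.mem_prod, Set.mem_Ioi, Set.mem_Ioi] at hp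
    refine ae_restrict_of_forall_mem (measurableSet_cube m) fun u hu => ?_
    rw [Real.norm_eq_abs]
    have := abs_redWeight_le_one (m := m) (b := b) (c := c) hp.1 hb hc hp.2.le hu
    simpa using this
  · exact integrableOn_const (by rw [volume_cube]; exact ENNReal.one_ne_top)
  · have h1 : ∀ᵐ u : Fin m → ℝ, ∀ j, u j ≠ 0 := by
      rw [ae_all_iff]
      intro j
      exact Measure.ae_eval_ne (fun _ : Fin m => (volume : Measure ℝ)) j 0
    filter_upwards [ae_restrict_of_ae h1, ae_restrict_mem (measurableSet_cube m)] with u hu hu'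
    rw [mem_cube_iff] at hu'
    exact tendsto_redWeight b c (by linarith) fun j => lt_of_le_of_ne (hu' j).1 (hu j).symm

/-! ### The limit `a → 0⁺` -/

/-- **Selberg's normalisation, integral side**: for `b, c ≥ 1`,
`a · S_{m+1}(a, b, c) → (m+1) · S_m(2c, b, c)` as `a → 0⁺`. [folklore] -/
theorem tendsto_mul_selbergIntegral_succ (m : ℕ) {b c : ℝ} (hb : 1 ≤ b) (hc : 1 ≤ c) :
    Tendsto (fun a => a * selbergIntegral (m + 1) a b c) (𝓝[>] 0)
      (𝓝 ((m + 1) * selbergIntegral m (2 * c) b c)) := by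
  set L := selbergIntegral m (2 * c) b c with hL
  -- the marginal `g a x = ∫_u 𝟙 W (x ∷ u)`
  set g : ℝ → ℝ → ℝ := fun a x =>
    ∫ u in cube m, (argminSet (m + 1) 0).indicator (weight (m + 1) a b c) (Fin.cons x u) with hg
  have hg_eq : ∀ a x, g a x = x ^ (a - 1) * ((1 - x) ^ (b - 1) *
      ∫ u in cube m, redWeight m b c (a, x) u) := by
    intro a x
    simp only [hg, indicator_weight_cons, integral_const_mul]
    ring
  -- Fubini for each `a > 0`
  have hfub : ∀ a, 0 < a →
      selbergIntegral (m + 1) a b c = (m + 1) * ∫ x in Ioo (0 : ℝ) 1, g a x ∧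
        IntegrableOn (g a) (Ioo 0 1) := by
    intro a ha
    have hW : IntegrableOn (weight (m + 1) a b c) (cube (m + 1)) :=
      integrableOn_weight ha (by linarith) (by linarith)
    have hD : IntegrableOn ((argminSet (m + 1) 0).indicator (weight (m + 1) a b c)) (cube (m + 1)) :=
      hW.indicator (measurableSet_argminSet _ 0)
    obtain ⟨h1, h2⟩ := integral_cube_succ' _ hD
    refine ⟨?_, h2.mono_set Ioo_subset_Icc_self⟩
    rw [selbergIntegral_eq_mul_integral_argmin hW, h1, integral_Icc_eq_integral_Ioo]
  -- the approximate identity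
  have hmain : Tendsto (fun a => a * ∫ x in Ioo (0 : ℝ) 1, g a x) (𝓝[>] 0) (𝓝 L) := by
    refine tendsto_mul_integral_of_approx (M := 1) zero_le_one (fun a ha _ => (hfub a ha).2)
      ?_ ?_
    · -- the bound `|g a x| ≤ x^{a-1}`
      intro a ha _ x hx
      rw [hg_eq, abs_mul, abs_of_nonneg (rpow_nonneg hx.1.le _), mul_comm]
      refine mul_le_mul_of_nonneg_right ?_ (rpow_nonneg hx.1.le _)
      rw [abs_mul, abs_of_nonneg (rpow_nonneg (by linarith [hx.2]) _)]
      refine mul_le_one₀ (rpow_le_one (by linarith [hx.2]) (by linarith [hx.1]) (by linarith))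
        (abs_nonneg _) ?_
      have h := norm_setIntegral_le_of_norm_le_const (μ := volume) (s := cube m)
        (f := redWeight m b c (a, x)) (C := 1) (by rw [volume_cube]; exact ENNReal.one_lt_top)
        fun u hu => by
          rw [Real.norm_eq_abs]; exact abs_redWeight_le_one ha hb hc hx.1.le hu
      rw [Real.norm_eq_abs, Measure.real, volume_cube] at h
      simpa using h
    · -- the limit `|g a x - L x^{a-1}| ≤ ε x^{a-1}` for `a, x` small
      intro ε hε
      have hH : Tendsto (fun p : ℝ × ℝ => (1 - p.2) ^ (b - 1) *
          ∫ u in cube m, redWeight m b c p u) (𝓝[Set.Ioi 0 ×ˢ Set.Ioi 0] ((0 : ℝ), (0 : ℝ)))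
          (𝓝 (1 * L)) := by
        refine Tendsto.mul ?_ (tendsto_integral_redWeight m hb hc)
        have hcont : Continuous fun x : ℝ => (1 - x) ^ (b - 1) :=
          Continuous.rpow_const (by fun_prop) fun _ => Or.inr (by linarith)
        have h2 : Tendsto (fun p : ℝ × ℝ => p.2) (𝓝[Set.Ioi 0 ×ˢ Set.Ioi 0] ((0 : ℝ), (0 : ℝ)))
            (𝓝 0) :=
          (continuous_snd.tendsto ((0 : ℝ), (0 : ℝ))).mono_left nhdsWithin_le_nhds
        have h3 := (hcont.tendsto 0).comp h2
        simp only [sub_zero, Real.one_rpow] at h3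
        exact h3
      rw [one_mul] at hH
      obtain ⟨δ, hδ, hδlim⟩ := Metric.tendsto_nhdsWithin_nhds.1 hH ε hε
      refine ⟨δ, hδ, fun a ha haδ x hx hxδ => ?_⟩
      have hdist : dist ((a, x) : ℝ × ℝ) (0, 0) < δ := by
        rw [Prod.dist_eq, Real.dist_eq, Real.dist_eq, sub_zero, sub_zero, abs_of_pos ha,
          abs_of_pos hx]
        exact max_lt haδ hxδ
      have h := hδlim (x := (a, x)) ⟨ha, hx⟩ hdist
      rw [Real.dist_eq] at h
      rw [hg_eq, mul_comm L (x ^ (a - 1)), ← mul_sub, abs_mul, abs_of_nonneg (rpow_nonneg hx.le _),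
        mul_comm]
      exact mul_le_mul_of_nonneg_right h.le (rpow_nonneg hx.le _)
  -- conclusion
  have h2 : Tendsto (fun a => (m + 1 : ℝ) * (a * ∫ x in Ioo (0 : ℝ) 1, g a x)) (𝓝[>] 0)
      (𝓝 ((m + 1) * L)) := hmain.const_mul _
  refine h2.congr' ?_
  filter_upwards [self_mem_nhdsWithin] with a ha
  rw [(hfub a ha).1]
  ring

end Selberg

end Literature.Analysis.SpecialFunctions

end
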